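import Summits.AtomisticToContinuum.HydrodynamicLimit.Theses.LambertianContactSwap
import Summits.AtomisticToContinuum.HydrodynamicLimit.Theorems.LambertianContactSwapSwapGapEntropyTransfer
import Summits.AtomisticToContinuum.HydrodynamicLimit.Theorems.LambertianContactSwapLambertianEulerEntropyBudget
import Literature.MathematicalPhysics.KineticTheory.LambertianHardSphereFlow
import HarnessLib

/-!
# `SwapGap` (stmt-AtomisticToContinuum-11850), line `Sketch`, glue stub G3: `RelEntSwap → FieldRelEntSwap`

Helper file (`--supports stmt-AtomisticToContinuum-11850`) of line `Sketch` (card `entropy-relative-to-lambertian-law`) for the crux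
`Summit.AtomisticToContinuum.HydrodynamicLimit.Theses.LambertianContactSwap.SwapGap`, registered stub
`stub_fieldRelEntSwap_of_relEntSwap` of the lead's skeleton v6: the `o(N)` relative entropy of the full `N`-body laws
(`p_t = (Φ_t)_* P_N` vs `q_t = (Λ_t)_* (P_N ⊗ γ^ℕ)`, stub S1) gives the `o(N)` relative entropy of the laws of the `χ`-tested
field triple `(ρ_χ, m_χ, e_χ)` (statement S1″), by the data-processing inequality for the measurable map `z ↦ fld(z, χ)`.

prover-line-stmt-AtomisticToContinuum-11850-c3-0 (wave 4 worker), cycle 4.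
-/

noncomputable section

open MeasureTheory Filter Set Topology InformationTheory
open scoped ENNReal

namespace Summit.AtomisticToContinuum.HydrodynamicLimit.Theorems

open Literature.Analysis.FluidPDE Literature.MathematicalPhysics.KineticTheory
open Summit.AtomisticToContinuum.HydrodynamicLimit.Theses.LambertianContactSwap

open Summit.AtomisticToContinuum.HydrodynamicLimit.Theorems.LambertianContactSwapLambertianEulerEntropyBudget

/-- **Data processing for a deterministic measurable map** (the form used below): for finite measures
`μ`, `ν`, measurable `f : α → γ`, `f' : β → γ` into a standard Borel space `γ` and a measurable
`g : γ → δ`, `KL((g ∘ f)_* μ ‖ (g ∘ f')_* ν) ≤ KL(f_* μ ‖ f'_* ν)` — `Literature.Probability.Entropy.klDiv_comp_le`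
for the deterministic Markov kernel of `g` (`Measure.deterministic_comp_eq_map`) and `Measure.map_map`.
[folklore] -/
theorem klDiv_map_comp_le_klDiv_map {α β γ δ : Type*} [MeasurableSpace α] [MeasurableSpace β]
    [MeasurableSpace γ] [StandardBorelSpace γ] [Nonempty γ] [MeasurableSpace δ]
    (μ : Measure α) [IsFiniteMeasure μ] (ν : Measure β) [IsFiniteMeasure ν]
    {f : α → γ} {f' : β → γ} {g : γ → δ} (hf : Measurable f) (hf' : Measurable f')
    (hg : Measurable g) :
    klDiv (μ.map fun x => g (f x)) (ν.map fun y => g (f' y)) ≤ klDiv (μ.map f) (ν.map f') := by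
  have h := Literature.Probability.Entropy.klDiv_comp_le (μ.map f) (ν.map f')
    (ProbabilityTheory.Kernel.deterministic g hg)
  rw [Measure.deterministic_comp_eq_map, Measure.deterministic_comp_eq_map, Measure.map_map hg hf,
    Measure.map_map hg hf'] at h
  exact h

/-- **S1 ⟹ S1″ (field-level relative entropy swap)**: data processing through the measurable field-triple map
`z ↦ (ρ_χ(z), m_χ(z), e_χ(z))` — `KL(g_* μ ‖ g_* ν) ≤ KL(μ ‖ ν)` (`Literature.Probability.Entropy.klDiv_comp_le` with the
deterministic kernel of `g`; the phase space is standard Borel, `standardBorelSpace_config`), `Measure.map_map`, and the squeeze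
`0 ≤ KL(field laws)/(N+1) ≤ KL(p_t ‖ q_t)/(N+1) → 0`. [folklore] -/
theorem stub_fieldRelEntSwap_of_relEntSwap
    (hS1 :
    ∀ (a₀ θ₀ : T3 → ℝ) (u₀ : T3 → V3), Continuous a₀ → Continuous θ₀ → Continuous u₀ →
      (∀ x, 0 < a₀ x) → (∀ x, 0 < θ₀ x) →
      ∃ σ₀ : ℝ, 0 < σ₀ ∧ ∀ σ : ℝ, 0 < σ → σ < σ₀ →
        ∀ (T : ℝ) (ρ θ : ℝ → T3 → ℝ) (u : ℝ → T3 → V3), IsHardSphereEulerSolution σ T ρ u θ →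
          ∀ Φ : (N : ℕ) → HardSphereFlow (Torus.geometry (Fin 3)) (hsDiameter σ N) (N + 1),
            TendstoHydroFieldsAt (fun N => localGibbsLaw σ a₀ u₀ θ₀ N (Φ N)) Φ ρ u θ 0 →
              ∀ t ∈ Set.Ico 0 T,
                Tendsto (fun N : ℕ =>
                  klDiv ((localGibbsLaw σ a₀ u₀ θ₀ N (Φ N)).map ((Φ N).flow t))
                    (((localGibbsLaw σ a₀ u₀ θ₀ N (Φ N)).prod (lambertNoise (Fin 3))).map
                      (fun p => lambertFlow (Torus.geometry (Fin 3)) (hsDiameter σ N) p.2 p.1 t)) /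
                  ((N : ℝ≥0∞) + 1)) atTop (𝓝 0)) :
    ∀ (a₀ θ₀ : T3 → ℝ) (u₀ : T3 → V3), Continuous a₀ → Continuous θ₀ → Continuous u₀ →
      (∀ x, 0 < a₀ x) → (∀ x, 0 < θ₀ x) →
      ∃ σ₀ : ℝ, 0 < σ₀ ∧ ∀ σ : ℝ, 0 < σ → σ < σ₀ →
        ∀ (T : ℝ) (ρ θ : ℝ → T3 → ℝ) (u : ℝ → T3 → V3), IsHardSphereEulerSolution σ T ρ u θ →
          ∀ Φ : (N : ℕ) → HardSphereFlow (Torus.geometry (Fin 3)) (hsDiameter σ N) (N + 1),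
            TendstoHydroFieldsAt (fun N => localGibbsLaw σ a₀ u₀ θ₀ N (Φ N)) Φ ρ u θ 0 →
              ∀ t ∈ Set.Ico 0 T, ∀ χ : T3 → ℝ, Continuous χ →
                Tendsto (fun N : ℕ =>
                  klDiv
                    ((localGibbsLaw σ a₀ u₀ θ₀ N (Φ N)).map (fun z =>
                      (empiricalDensityField ((Φ N).flow t z) χ,
                        empiricalMomentumField ((Φ N).flow t z) χ,
                        empiricalEnergyField ((Φ N).flow t z) χ)))
                    (((localGibbsLaw σ a₀ u₀ θ₀ N (Φ N)).prod (lambertNoise (Fin 3))).map (fun p =>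
                      (empiricalDensityField
                          (lambertFlow (Torus.geometry (Fin 3)) (hsDiameter σ N) p.2 p.1 t) χ,
                        empiricalMomentumField
                          (lambertFlow (Torus.geometry (Fin 3)) (hsDiameter σ N) p.2 p.1 t) χ,
                        empiricalEnergyField
                          (lambertFlow (Torus.geometry (Fin 3)) (hsDiameter σ N) p.2 p.1 t) χ))) /
                  ((N : ℝ≥0∞) + 1)) atTop (𝓝 0) := by
  intro a₀ θ₀ u₀ ha hθ hu ha0 hθ0
  obtain ⟨σ₁, hσ₁, h1⟩ := hS1 a₀ θ₀ u₀ ha hθ hu ha0 hθ0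
  refine ⟨min 2⁻¹ σ₁, lt_min (by norm_num) hσ₁, ?_⟩
  intro σ hσ hσlt T ρ θ u hE Φ h0 t ht χ hχ
  have hσhalf : σ < 2⁻¹ := hσlt.trans_le (min_le_left _ _)
  have hσ₁' : σ < σ₁ := hσlt.trans_le (min_le_right _ _)
  -- S1 at these data
  have hlim := h1 σ hσ hσ₁' T ρ θ u hE Φ h0 t ht
  -- the local Gibbs laws are probability measures (`σ ≤ 1/2`)
  have hPN : ∀ N, IsProbabilityMeasure (localGibbsLaw σ a₀ u₀ θ₀ N (Φ N)) := fun N =>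
    isProbabilityMeasure_localGibbsLaw ha hθ hu ha0 hθ0 (by linarith) N (Φ N)
  -- joint measurability of the Lambertian flow (`σ < 1/2`)
  have hΛ : ∀ N, Measurable fun p : Config (N + 1) (Fin 3) T3 × (ℕ → V3) =>
      lambertFlow (Torus.geometry (Fin 3)) (hsDiameter σ N) p.2 p.1 t :=
    fun N => measurable_lambertFlow_hsDiameter hσ.le hσhalf N t
  -- squeeze `0 ≤ KL(field laws)/(N+1) ≤ KL(p_t ‖ q_t)/(N+1) → 0`, the middle inequality by data processing
  refine tendsto_of_tendsto_of_tendsto_of_le_of_le tendsto_const_nhds hlim (fun _ => zero_le)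
    fun N => ?_
  haveI := hPN N
  haveI : StandardBorelSpace (Config (N + 1) (Fin 3) T3) := standardBorelSpace_config (N + 1)
  exact ENNReal.div_le_div_right
    (klDiv_map_comp_le_klDiv_map _ _ ((Φ N).measurable_flow t) (hΛ N) (measurable_fieldTriple hχ)) _

end Summit.AtomisticToContinuum.HydrodynamicLimit.Theorems
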